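import Mathlib
import Summits.NavierStokesRegularity.NavierStokesRegularity.Theorems.EulerZoomLiouvillePowerGaugeEulerLiouvilleSelfSimilarLEI
import Summits.NavierStokesRegularity.NavierStokesRegularity.Theorems.EulerZoomLiouvillePowerGaugeEulerLiouvilleDSSEndpointSlices
import HarnessLib

/-!
# Rung C2 of the crux `EulerZoomLiouville.PowerGaugeEulerLiouville` at the endpoint `ρ = 1/2`:
# tools for the local energy EQUALITY of energy-conserving members

Route №10 `EulerZoomLiouville` (NavierStokesRegularity), crux E = stmt-NavierStokesRegularity-19832,
tenure rung C2 (`Sig.rungC2_dss`) at the energy-conserving endpoint `ρ = 1/2`.  Generic tools for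
`…DSSEndpointLocalEnergyEquality`:

* `energyFlux_integrable`, `localEnergy_nonneg` — the class functional
  `L(ψ) = ∫∫ (|u|² ∂_tψ + (|u|²+2p)⟪u,∇ψ⟫)` of a space–time test `ψ` as ONE integral over `ℝ × ℝ³`
  (integrable integrand), nonnegative on nonnegative tests (CKN (2.5) with `ν = 0`, `f = 0`);
* `integrable_timecut_energy`, `integrable_timecut_energy_mul` — `θ(t)|u|²(σ(x))` is integrable on
  `ℝ × ℝ³` for a continuous time weight `θ` vanishing off a compact interval of negative times and a
  space weight `0 ≤ σ ≤ 1`, from `sup_τ ∫|u(τ)|² ≤ c` (Tonelli on the strip);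
* `tendsto_integral_timecut_energy` — if moreover the energy is a.e. CONSTANT `= E₀` and `∫θ = 0`, then
  against exhausting space cut-offs `σ_k ↑ 1`: `∫ θ|u|²σ_k → E₀ ∫θ = 0` (dominated convergence, Fubini).

WHAT THIS IS NOT: not NS, not E, not rung C2 — measure-theoretic tools, `--supports` stmt-19832.
-/

noncomputable section

-- flat `Theorems/<Route><Decl>…` files of one crux share the namespace of the crux (tree convention)
set_option linter.dupNamespace false

open MeasureTheory Set Filter Topology Metric Function TopologicalSpace
open scoped ENNReal NNReal InnerProductSpace RealInnerProductSpace

namespace Summit.NavierStokesRegularity.NavierStokesRegularity.Theorems.PowerGaugeEulerLiouville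

open Literature.Analysis Literature.Analysis.FunctionSpaces Literature.Analysis.FluidPDE

section Functional

variable {u : ℝ → EuclideanSpace ℝ (Fin 3) → EuclideanSpace ℝ (Fin 3)}
  {p : ℝ → EuclideanSpace ℝ (Fin 3) → ℝ}

/-- **The energy-flux integrand of a test is integrable on `ℝ × ℝ³`, and the class functional is one
integral.**  For a suitable weak Euler/NS pair on the slab and a space–time test `ψ` on the slab,
`z ↦ |u|² ∂_tψ + (|u|²+2p)⟪u, ∇ψ⟫` is integrable on `ℝ × ℝ³` and
`∫ t, ∫ x, (…) = ∫ z, (…)`. [folklore] -/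
theorem energyFlux_integrable {ν : ℝ}
    (hsw : IsSuitableWeakSolutionOn (slab (EuclideanSpace ℝ (Fin 3)) (Iio 0) isOpen_Iio) ν 0 u p)
    {ψ : ℝ → EuclideanSpace ℝ (Fin 3) → ℝ}
    (hψ : IsSpaceTimeTestOn (slab (EuclideanSpace ℝ (Fin 3)) (Iio 0) isOpen_Iio) ψ) :
    Integrable (fun z : ℝ × EuclideanSpace ℝ (Fin 3) => ‖u z.1 z.2‖ ^ 2 * timeDeriv ψ z.1 z.2 +
        (‖u z.1 z.2‖ ^ 2 + 2 * p z.1 z.2) * ⟪u z.1 z.2, gradient (ψ z.1) z.2⟫) volume ∧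
      (∫ t, ∫ x, (‖u t x‖ ^ 2 * timeDeriv ψ t x + (‖u t x‖ ^ 2 + 2 * p t x) * ⟪u t x, gradient (ψ t) x⟫)) =
        ∫ z : ℝ × EuclideanSpace ℝ (Fin 3), (‖u z.1 z.2‖ ^ 2 * timeDeriv ψ z.1 z.2 +
          (‖u z.1 z.2‖ ^ 2 + 2 * p z.1 z.2) * ⟪u z.1 z.2, gradient (ψ z.1) z.2⟫) := by
  set Q : Opens (ℝ × EuclideanSpace ℝ (Fin 3)) := slab (EuclideanSpace ℝ (Fin 3)) (Iio 0) isOpen_Iio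
    with hQ
  set K := tsupport (uncurry ψ) with hK
  have hKc : IsCompact K := hψ.hasCompactSupport
  have hKQ : K ⊆ (Q : Set (ℝ × EuclideanSpace ℝ (Fin 3))) := hψ.tsupport_subset
  have hψ' : IsSpaceTimeTestOn (⊤ : Opens (ℝ × EuclideanSpace ℝ (Fin 3))) ψ := hψ.mono le_top
  have hcT : Continuous fun z : ℝ × EuclideanSpace ℝ (Fin 3) => timeDeriv ψ z.1 z.2 :=
    hψ'.timeDeriv_top.contDiff.continuous
  obtain ⟨hcg, -, hg0⟩ := hψ.continuous_gradient_field
  have hTK : ∀ z ∉ K, timeDeriv ψ z.1 z.2 = 0 := fun z hz =>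
    IsSpaceTimeTestOn.timeDeriv_eq_zero_of_notMem hz
  have hu2 : LocallyIntegrableOn (fun z : ℝ × EuclideanSpace ℝ (Fin 3) => ‖u z.1 z.2‖ ^ 2)
      (Q : Set (ℝ × EuclideanSpace ℝ (Fin 3))) volume := hsw.distributional.2.1
  have hu3 := locallyIntegrableOn_cube_of_suitable hsw
  have h1 : Integrable (fun z : ℝ × EuclideanSpace ℝ (Fin 3) => ‖u z.1 z.2‖ ^ 2 * timeDeriv ψ z.1 z.2)
      (volume : Measure (ℝ × EuclideanSpace ℝ (Fin 3))) :=
    integrable_mul_of_locallyIntegrableOn hu2 hcT hKc hKQ hTK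
  have h2 : Integrable (fun z : ℝ × EuclideanSpace ℝ (Fin 3) =>
      ⟪(fun t x => (‖u t x‖ ^ 2 + 2 * p t x) • u t x) z.1 z.2, gradient (ψ z.1) z.2⟫)
      (volume : Measure (ℝ × EuclideanSpace ℝ (Fin 3))) :=
    integrable_inner_of_locallyIntegrableOn (hsw.locallyIntegrableOn_cubic hu3) hcg hKc hKQ hg0
  have hI : Integrable (fun z : ℝ × EuclideanSpace ℝ (Fin 3) => ‖u z.1 z.2‖ ^ 2 * timeDeriv ψ z.1 z.2 +
      (‖u z.1 z.2‖ ^ 2 + 2 * p z.1 z.2) * ⟪u z.1 z.2, gradient (ψ z.1) z.2⟫) volume := by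
    refine (h1.add h2).congr (Eventually.of_forall fun z => ?_)
    simp only [Pi.add_apply, real_inner_smul_left]
  refine ⟨hI, ?_⟩
  rw [Measure.volume_eq_prod, integral_prod _ (by rw [← Measure.volume_eq_prod]; exact hI)]

/-- **The class functional is nonnegative on nonnegative tests** (`ν = 0`, `f = 0`: CKN (2.5) reads
`0 ≤ ∫∫ |u|² ∂_tψ + (|u|²+2p)⟪u,∇ψ⟫`). [cite: CaffarelliKohnNirenberg1982, §2 (2.5)] -/
theorem localEnergy_nonneg
    (hsw : IsSuitableWeakSolutionOn (slab (EuclideanSpace ℝ (Fin 3)) (Iio 0) isOpen_Iio) 0 0 u p)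
    {ψ : ℝ → EuclideanSpace ℝ (Fin 3) → ℝ}
    (hψ : IsSpaceTimeTestOn (slab (EuclideanSpace ℝ (Fin 3)) (Iio 0) isOpen_Iio) ψ)
    (hψ0 : ∀ t x, 0 ≤ ψ t x) :
    0 ≤ ∫ z : ℝ × EuclideanSpace ℝ (Fin 3), (‖u z.1 z.2‖ ^ 2 * timeDeriv ψ z.1 z.2 +
        (‖u z.1 z.2‖ ^ 2 + 2 * p z.1 z.2) * ⟪u z.1 z.2, gradient (ψ z.1) z.2⟫) := by
  obtain ⟨G, -, -, hLEI⟩ := hsw.localEnergy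
  have h := hLEI ψ hψ hψ0
  simp only [mul_zero, zero_mul, add_zero, Pi.zero_apply, inner_zero_left] at h
  rw [(energyFlux_integrable hsw hψ).2] at h
  exact h

/-- **A time weight times the energy density is integrable on `ℝ × ℝ³`.**  If `u` is measurable on the
slab with `sup_{τ<0} ∫|u(τ)|² ≤ c`, and `θ` is continuous and vanishes off `[a₁, b₁]` with `b₁ < 0`, then
`z ↦ θ(z.1) |u z|²` is integrable on `ℝ × ℝ³` (Tonelli on the strip `[a₁,b₁] × ℝ³`). [folklore] -/
theorem integrable_timecut_energy {c : ℝ≥0}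
    (hum : AEStronglyMeasurable (uncurry u)
      (volume.restrict (Iio (0 : ℝ) ×ˢ (univ : Set (EuclideanSpace ℝ (Fin 3))))))
    (hfin : ∀ τ : ℝ, τ < 0 → ∫⁻ y, ‖u τ y‖ₑ ^ 2 ≤ c)
    {θ : ℝ → ℝ} (hθ : Continuous θ) {a₁ b₁ : ℝ} (hb₁ : b₁ < 0)
    (hθ0 : ∀ t, t ∉ Icc a₁ b₁ → θ t = 0) :
    Integrable (fun z : ℝ × EuclideanSpace ℝ (Fin 3) => θ z.1 * ‖u z.1 z.2‖ ^ 2) volume := by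
  set S : Set (ℝ × EuclideanSpace ℝ (Fin 3)) := Icc a₁ b₁ ×ˢ univ with hS
  have hSm : MeasurableSet S := measurableSet_Icc.prod MeasurableSet.univ
  have hSsub : S ⊆ Iio (0 : ℝ) ×ˢ (univ : Set (EuclideanSpace ℝ (Fin 3))) :=
    prod_mono (fun t ht => lt_of_le_of_lt ht.2 hb₁) subset_rfl
  obtain ⟨Cθ, hCθ⟩ := hθ.bounded_above_of_compact_support
    (HasCompactSupport.intro isCompact_Icc hθ0)
  have hCθ0 : 0 ≤ Cθ := (norm_nonneg _).trans (hCθ 0)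
  -- the function vanishes off the strip
  have hind : (fun z : ℝ × EuclideanSpace ℝ (Fin 3) => θ z.1 * ‖u z.1 z.2‖ ^ 2) =
      S.indicator (fun z => θ z.1 * ‖u z.1 z.2‖ ^ 2) := by
    funext z
    by_cases hz : z ∈ S
    · rw [indicator_of_mem hz]
    · rw [indicator_of_notMem hz, hθ0 z.1 (fun h => hz ⟨h, mem_univ _⟩), zero_mul]
  rw [hind, integrable_indicator_iff hSm]
  have humS : AEStronglyMeasurable (uncurry u) (volume.restrict S) :=
    hum.mono_measure (Measure.restrict_mono hSsub le_rfl)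
  refine ⟨((hθ.comp continuous_fst).aestronglyMeasurable).mul (humS.norm.pow 2), ?_⟩
  -- Tonelli on the strip
  have hprod : (volume.restrict (Icc a₁ b₁)).prod (volume : Measure (EuclideanSpace ℝ (Fin 3))) =
      volume.restrict S := by
    rw [hS, Measure.restrict_prod_eq_prod_univ, ← Measure.volume_eq_prod]
  have humS' : AEStronglyMeasurable (uncurry u)
      ((volume.restrict (Icc a₁ b₁)).prod (volume : Measure (EuclideanSpace ℝ (Fin 3)))) := by
    rw [hprod]; exact humS
  rw [HasFiniteIntegral]
  calc ∫⁻ z in S, ‖θ z.1 * ‖u z.1 z.2‖ ^ 2‖ₑ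
      ≤ ∫⁻ z in S, ENNReal.ofReal Cθ * ‖u z.1 z.2‖ₑ ^ 2 := by
        refine lintegral_mono fun z => ?_
        rw [enorm_mul, Real.enorm_eq_ofReal (by positivity : (0 : ℝ) ≤ ‖u z.1 z.2‖ ^ 2),
          ENNReal.ofReal_pow (norm_nonneg _), ofReal_norm, Real.enorm_eq_ofReal_abs]
        gcongr
        exact (Real.norm_eq_abs _).symm.le.trans (hCθ z.1)
    _ = ENNReal.ofReal Cθ * ∫⁻ z in S, ‖u z.1 z.2‖ₑ ^ 2 := by
        rw [lintegral_const_mul'' (f := fun z : ℝ × EuclideanSpace ℝ (Fin 3) => ‖u z.1 z.2‖ₑ ^ 2) _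
          (humS.aemeasurable.enorm.pow_const 2)]
    _ = ENNReal.ofReal Cθ * ∫⁻ t in Icc a₁ b₁, ∫⁻ x, ‖u t x‖ₑ ^ 2 := by
        rw [← hprod, lintegral_prod (fun z : ℝ × EuclideanSpace ℝ (Fin 3) => ‖u z.1 z.2‖ₑ ^ 2)
          (humS'.aemeasurable.enorm.pow_const 2)]
    _ ≤ ENNReal.ofReal Cθ * ∫⁻ _ in Icc a₁ b₁, (c : ℝ≥0∞) :=
        mul_le_mul' le_rfl
          (setLIntegral_mono' measurableSet_Icc fun t ht => hfin t (lt_of_le_of_lt ht.2 hb₁))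
    _ < ⊤ := by
        rw [setLIntegral_const, Real.volume_Icc]
        exact ENNReal.mul_lt_top ENNReal.ofReal_lt_top
          (ENNReal.mul_lt_top ENNReal.coe_lt_top ENNReal.ofReal_lt_top)

/-- … and so is its product with a continuous space weight `0 ≤ σ ≤ 1`. [folklore] -/
theorem integrable_timecut_energy_mul {c : ℝ≥0}
    (hum : AEStronglyMeasurable (uncurry u)
      (volume.restrict (Iio (0 : ℝ) ×ˢ (univ : Set (EuclideanSpace ℝ (Fin 3))))))
    (hfin : ∀ τ : ℝ, τ < 0 → ∫⁻ y, ‖u τ y‖ₑ ^ 2 ≤ c)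
    {θ : ℝ → ℝ} (hθ : Continuous θ) {a₁ b₁ : ℝ} (hb₁ : b₁ < 0)
    (hθ0 : ∀ t, t ∉ Icc a₁ b₁ → θ t = 0) {σ : EuclideanSpace ℝ (Fin 3) → ℝ} (hσ : Continuous σ)
    (hσ0 : ∀ x, 0 ≤ σ x) (hσ1 : ∀ x, σ x ≤ 1) :
    Integrable (fun z : ℝ × EuclideanSpace ℝ (Fin 3) => θ z.1 * ‖u z.1 z.2‖ ^ 2 * σ z.2) volume := by
  have hD := integrable_timecut_energy hum hfin hθ hb₁ hθ0
  refine hD.norm.mono' (hD.aestronglyMeasurable.mul (hσ.comp continuous_snd).aestronglyMeasurable)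
    (Eventually.of_forall fun z => ?_)
  rw [norm_mul, Real.norm_of_nonneg (hσ0 z.2)]
  exact mul_le_of_le_one_right (norm_nonneg _) (hσ1 z.2)

/-- **The time-cut energy integral against exhausting space cut-offs tends to `E₀ ∫θ' = 0`.**  With `u`
as above and its energy a.e. constant (`∫|u(τ)|² = E₀` for a.e. `τ < 0`), a continuous `θ` vanishing off
`[a₁,b₁]`, `b₁ < 0`, with `∫ θ = 0`, and continuous space weights `0 ≤ σ_k ≤ 1`, eventually `= 1` at each
point: `∫ θ(t)|u|²σ_k → 0` (dominated convergence, then Fubini). [folklore] -/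
theorem tendsto_integral_timecut_energy {c : ℝ≥0}
    (hum : AEStronglyMeasurable (uncurry u)
      (volume.restrict (Iio (0 : ℝ) ×ˢ (univ : Set (EuclideanSpace ℝ (Fin 3))))))
    (hfin : ∀ τ : ℝ, τ < 0 → ∫⁻ y, ‖u τ y‖ₑ ^ 2 ≤ c)
    {E₀ : ℝ≥0∞} (hE : ∀ᵐ τ : ℝ, τ < 0 → ∫⁻ y, ‖u τ y‖ₑ ^ 2 = E₀)
    {θ : ℝ → ℝ} (hθ : Continuous θ) {a₁ b₁ : ℝ} (hb₁ : b₁ < 0)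
    (hθ0 : ∀ t, t ∉ Icc a₁ b₁ → θ t = 0) (hθi : ∫ t, θ t = 0)
    {σ : ℕ → EuclideanSpace ℝ (Fin 3) → ℝ} (hσ : ∀ k, Continuous (σ k))
    (hσ0 : ∀ k x, 0 ≤ σ k x) (hσ1 : ∀ k x, σ k x ≤ 1) (hσlim : ∀ x, ∀ᶠ k in atTop, σ k x = 1) :
    Tendsto (fun k => ∫ z : ℝ × EuclideanSpace ℝ (Fin 3), θ z.1 * ‖u z.1 z.2‖ ^ 2 * σ k z.2)
      atTop (𝓝 0) := by
  have hD := integrable_timecut_energy hum hfin hθ hb₁ hθ0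
  -- dominated convergence: `θ|u|²σ_k → θ|u|²`
  have hlim : Tendsto (fun k => ∫ z : ℝ × EuclideanSpace ℝ (Fin 3), θ z.1 * ‖u z.1 z.2‖ ^ 2 * σ k z.2)
      atTop (𝓝 (∫ z : ℝ × EuclideanSpace ℝ (Fin 3), θ z.1 * ‖u z.1 z.2‖ ^ 2)) := by
    refine tendsto_integral_of_dominated_convergence (fun z => ‖θ z.1 * ‖u z.1 z.2‖ ^ 2‖)
      (fun k => hD.aestronglyMeasurable.mul ((hσ k).comp continuous_snd).aestronglyMeasurable)
      hD.norm (fun k => Eventually.of_forall fun z => ?_) (Eventually.of_forall fun z => ?_)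
    · rw [norm_mul, Real.norm_of_nonneg (hσ0 k z.2)]
      exact mul_le_of_le_one_right (norm_nonneg _) (hσ1 k z.2)
    · exact tendsto_const_nhds.congr' ((hσlim z.2).mono fun k hk => by
        show θ z.1 * ‖u z.1 z.2‖ ^ 2 = θ z.1 * ‖u z.1 z.2‖ ^ 2 * σ k z.2
        rw [hk, mul_one])
  -- the limit is `E₀ ∫ θ = 0`
  have hslice : ∀ᵐ t : ℝ, t < 0 → AEStronglyMeasurable (u t) volume :=
    ae_slice_aestronglyMeasurable hum
  have hval : (∫ z : ℝ × EuclideanSpace ℝ (Fin 3), θ z.1 * ‖u z.1 z.2‖ ^ 2) = 0 := by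
    rw [Measure.volume_eq_prod, integral_prod _ (by rw [← Measure.volume_eq_prod]; exact hD)]
    have hae : (fun t => ∫ x, θ t * ‖u t x‖ ^ 2) =ᵐ[volume] fun t => θ t * E₀.toReal := by
      filter_upwards [hE, hslice] with t hEt hst
      rw [integral_const_mul]
      by_cases ht : t < 0
      · congr 1
        have hm : AEStronglyMeasurable (fun x => ‖u t x‖ ^ 2) volume := (hst ht).norm.pow 2
        rw [integral_eq_lintegral_of_nonneg_ae (f := fun x => ‖u t x‖ ^ 2)
          (Eventually.of_forall fun x => (by positivity : (0 : ℝ) ≤ ‖u t x‖ ^ 2)) hm, ← hEt ht]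
        congr 1
        refine lintegral_congr_ae (Eventually.of_forall fun x => ?_)
        show ENNReal.ofReal (‖u t x‖ ^ 2) = ‖u t x‖ₑ ^ 2
        rw [ENNReal.ofReal_pow (norm_nonneg _), ofReal_norm]
      · rw [hθ0 t (fun h => ht (lt_of_le_of_lt h.2 hb₁)), zero_mul, zero_mul]
    change (∫ t, ∫ x, θ t * ‖u t x‖ ^ 2) = 0
    rw [integral_congr_ae hae, integral_mul_const, hθi, zero_mul]
  rw [hval] at hlim
  exact hlim

end Functional

end Summit.NavierStokesRegularity.NavierStokesRegularity.Theorems.PowerGaugeEulerLiouville
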